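import Summits.CriticalPhenomena.PercolationContinuityZ3.Theorems.PercNearOneGluingNoHeavyLowerTailConditionedChampionExchange
import HarnessLib

/-!
# `NoHeavyLowerTail` (stmt-CriticalPhenomena-4575) — SET CHAMPIONSHIP for pairs and the PAIR-ATTACHED exchange

Support file (lemma factory #8 `prim-lf-8`, gen 7; `--supports stmt-CriticalPhenomena-4575`).  No definitions, no named facts,
no sorries.  Notation as in `…ConditionedChampionExchange.lean`: `μ = prodBernoulli w`, relays `A`, level `j`,
`R_v = {|π(v)| ≤ j}` (`v` light), `S(v) = μ(R_v)`.

* `ConditionedChampionExchangeSets.setChampionship_pair` — **set championship for a pair**: if `S(y) ≤ S(q) ≤ S(c)` then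
  `μ({c↮q} ∩ {c↮y} ∩ R_q ∩ R_y) ≤ μ({c↮q} ∩ {c↮y} ∩ R_c)`:
  off its own connections to the pair, a relay that beats both members is at least as likely to be light as the pair is to be
  jointly light.  (For a single relay this is championship itself; the pair case is championship for `q` plus the conditioned
  exchange `conditionedChampionExchange_swap` applied with the OBSERVER `c`, the relay `y` and the champion `q`.)  Seat screens of the
  general set version (`|Q| ≤ 5`, every cell `k ≤ 7`, every `c` beating `Q`): 0 violations in 2.4·10⁴ cases (prim-lf-8 CANDIDATES v8 B8-4).
* `ConditionedChampionExchangeSets.exchange_typePlus_pair` — for every event `E` of type `(+)` for `(C_{{q,y}}, C_{{c}})`: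
  `μ(E ∩ R_q ∩ R_y) ≤ μ(E ∩ R_c)` (two-set exchange of van den Berg–Häggström–Kahn given `{q,y} ↮ c` + set championship).
* `pairAttachedExchange`, `pairAttachedExchange_swap` — the case `E = {o↔q} ∩ {o↔y}` (`π(o) ⊇ {q,y}`):
  `μ(π(o) ⊇ {q,y}, o light, c heavy) ≤ μ(π(o) ⊇ {q,y}, o heavy, c light)` — the exchange for observers attached to a PAIR of relays,
  the brick after `conditionedChampionExchange` (single relay) for the cells `j = |A| − 3`, where light pockets have at most two relays.
-/

noncomputable section

namespace Summit.CriticalPhenomena.PercolationContinuityZ3.Theorems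

open MeasureTheory Set Literature.Probability.LatticeModels Literature.Probability.Percolation
open scoped Classical BigOperators

variable {n : ℕ}

namespace ConditionedChampionExchangeSets

open ConditionedChampionExchange

/-- The two-set separation event of `{q, y}` and `{c}` is `{q ↮ c} ∩ {y ↮ c}`. [folklore] -/
theorem sep_pair_eq (q y c : Fin n) :
    {ω : BondConfig (Fin n) | ∀ s ∈ ({q, y} : Set (Fin n)), ∀ t ∈ ({c} : Set (Fin n)), ¬ (openGraph ω).Reachable s t} =
      (openConn q c : Set (BondConfig (Fin n)))ᶜ ∩ (openConn y c : Set (BondConfig (Fin n)))ᶜ := by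
  ext ω
  simp only [mem_setOf_eq, mem_insert_iff, mem_singleton_iff, forall_eq_or_imp, forall_eq, mem_inter_iff, mem_compl_iff]
  rfl

/-- Championship restricted to `{c ↮ q}`: `S(q) ≤ S(c)` gives `μ({c↮q} ∩ R_q) ≤ μ({c↮q} ∩ R_c)` (the `{c ↔ q}` parts agree). [folklore] -/
theorem championship_off (w : Sym2 (Fin n) → unitInterval) (A : Finset (Fin n)) (q c : Fin n) (j : ℕ)
    (hS : (prodBernoulli w).real {ω : BondConfig (Fin n) | (A.filter fun a => ω ∈ openConn q a).card ≤ j} ≤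
      (prodBernoulli w).real {ω : BondConfig (Fin n) | (A.filter fun a => ω ∈ openConn c a).card ≤ j}) :
    (prodBernoulli w).real ((openConn c q : Set (BondConfig (Fin n)))ᶜ ∩
        {ω | (A.filter fun a => ω ∈ openConn q a).card ≤ j}) ≤
      (prodBernoulli w).real ((openConn c q : Set (BondConfig (Fin n)))ᶜ ∩
        {ω | (A.filter fun a => ω ∈ openConn c a).card ≤ j}) := by
  set μ := prodBernoulli w with hμ
  set K : Set (BondConfig (Fin n)) := (openConn c q : Set (BondConfig (Fin n))) with hK
  set Lq : Set (BondConfig (Fin n)) := {ω | (A.filter fun a => ω ∈ openConn q a).card ≤ j} with hLq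
  set Lc : Set (BondConfig (Fin n)) := {ω | (A.filter fun a => ω ∈ openConn c a).card ≤ j} with hLc
  have hmeas : ∀ s : Set (BondConfig (Fin n)), MeasurableSet s := fun _ => MeasurableSet.of_discrete
  have split : ∀ F : Set (BondConfig (Fin n)), μ.real F = μ.real (F ∩ K) + μ.real (F ∩ Kᶜ) := by
    intro F
    rw [← Set.sdiff_eq]
    exact (measureReal_inter_add_sdiff (μ := μ) (s := F) (t := K) (hmeas _)).symm
  have e3 : Lq ∩ K = Lc ∩ K := by
    ext ω
    simp only [mem_inter_iff, hLq, hLc, mem_setOf_eq]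
    constructor
    · rintro ⟨hl, hk⟩; exact ⟨by rw [filter_eq_of_openConn A hk]; exact hl, hk⟩
    · rintro ⟨hl, hk⟩; exact ⟨by rw [← filter_eq_of_openConn A hk]; exact hl, hk⟩
  have e1 := split Lq
  have e2 := split Lc
  rw [inter_comm Kᶜ Lq, inter_comm Kᶜ Lc]
  linarith [e3 ▸ e1]

/-- **Set championship for a pair.**  If `S(y) ≤ S(q) ≤ S(c)` then
`μ({c↮q} ∩ {c↮y} ∩ R_q ∩ R_y) ≤ μ({c↮q} ∩ {c↮y} ∩ R_c)`. [this work] -/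
theorem setChampionship_pair (w : Sym2 (Fin n) → unitInterval) (A : Finset (Fin n)) (q y c : Fin n) (j : ℕ)
    (hqc : (prodBernoulli w).real {ω : BondConfig (Fin n) | (A.filter fun a => ω ∈ openConn q a).card ≤ j} ≤
      (prodBernoulli w).real {ω : BondConfig (Fin n) | (A.filter fun a => ω ∈ openConn c a).card ≤ j})
    (hyq : (prodBernoulli w).real {ω : BondConfig (Fin n) | (A.filter fun a => ω ∈ openConn y a).card ≤ j} ≤
      (prodBernoulli w).real {ω : BondConfig (Fin n) | (A.filter fun a => ω ∈ openConn q a).card ≤ j}) :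
    (prodBernoulli w).real ((openConn c q : Set (BondConfig (Fin n)))ᶜ ∩ (openConn c y : Set (BondConfig (Fin n)))ᶜ ∩
        {ω | (A.filter fun a => ω ∈ openConn q a).card ≤ j} ∩ {ω | (A.filter fun a => ω ∈ openConn y a).card ≤ j}) ≤
      (prodBernoulli w).real ((openConn c q : Set (BondConfig (Fin n)))ᶜ ∩ (openConn c y : Set (BondConfig (Fin n)))ᶜ ∩
        {ω | (A.filter fun a => ω ∈ openConn c a).card ≤ j}) := by
  set μ := prodBernoulli w with hμ
  set Kq : Set (BondConfig (Fin n)) := (openConn c q : Set (BondConfig (Fin n))) with hKq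
  set Ky : Set (BondConfig (Fin n)) := (openConn c y : Set (BondConfig (Fin n))) with hKy
  set Lq : Set (BondConfig (Fin n)) := {ω | (A.filter fun a => ω ∈ openConn q a).card ≤ j} with hLq
  set Ly : Set (BondConfig (Fin n)) := {ω | (A.filter fun a => ω ∈ openConn y a).card ≤ j} with hLy
  set Lc : Set (BondConfig (Fin n)) := {ω | (A.filter fun a => ω ∈ openConn c a).card ≤ j} with hLc
  set Hq : Set (BondConfig (Fin n)) := {ω | j < (A.filter fun a => ω ∈ openConn q a).card} with hHq
  set Hy : Set (BondConfig (Fin n)) := {ω | j < (A.filter fun a => ω ∈ openConn y a).card} with hHy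
  have hmeas : ∀ s : Set (BondConfig (Fin n)), MeasurableSet s := fun _ => MeasurableSet.of_discrete
  have hnn : ∀ s : Set (BondConfig (Fin n)), 0 ≤ μ.real s := fun _ => measureReal_nonneg
  -- generic splits
  have splitK : ∀ F : Set (BondConfig (Fin n)), μ.real F = μ.real (F ∩ Kyᶜ) + μ.real (F ∩ Ky) := by
    intro F
    have := (measureReal_inter_add_sdiff (μ := μ) (s := F) (t := Ky) (hmeas _)).symm
    rw [Set.sdiff_eq] at this
    linarith
  have splitL : ∀ F : Set (BondConfig (Fin n)), μ.real F = μ.real (F ∩ Ly) + μ.real (F ∩ Hy) := by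
    intro F
    have hc : F ∩ Hy = F \ Ly := by
      ext ω; simp only [mem_inter_iff, mem_sdiff, hLy, hHy, mem_setOf_eq, not_le]
    rw [hc]
    exact (measureReal_inter_add_sdiff (μ := μ) (s := F) (t := Ly) (hmeas _)).symm
  have splitLq : ∀ F : Set (BondConfig (Fin n)), μ.real F = μ.real (F ∩ Lq) + μ.real (F ∩ Hq) := by
    intro F
    have hc : F ∩ Hq = F \ Lq := by
      ext ω; simp only [mem_inter_iff, mem_sdiff, hLq, hHq, mem_setOf_eq, not_le]
    rw [hc]
    exact (measureReal_inter_add_sdiff (μ := μ) (s := F) (t := Lq) (hmeas _)).symm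
  -- (1) championship of `c` over `q` off `{c ↔ q}`
  have h1 : μ.real (Kqᶜ ∩ Lq) ≤ μ.real (Kqᶜ ∩ Lc) := championship_off w A q c j hqc
  -- (2) on `{c ↔ y}` the events `R_c`, `R_y` agree
  have h2 : Kqᶜ ∩ Lc ∩ Ky = Kqᶜ ∩ Ly ∩ Ky := by
    ext ω
    simp only [mem_inter_iff, hLc, hLy, mem_setOf_eq]
    constructor
    · rintro ⟨⟨hk, hl⟩, hky⟩; exact ⟨⟨hk, by rw [← filter_eq_of_openConn A hky]; exact hl⟩, hky⟩
    · rintro ⟨⟨hk, hl⟩, hky⟩; exact ⟨⟨hk, by rw [filter_eq_of_openConn A hky]; exact hl⟩, hky⟩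
  -- (3) the exchange with observer `c`, relay `y`, champion `q`
  have h3 := conditionedChampionExchange_swap w A c y q j hyq
  change μ.real (Ky ∩ Ly ∩ Hq) ≤ μ.real (Ky ∩ Hy ∩ Lq) at h3
  have h3a : μ.real (Kqᶜ ∩ Ly ∩ Ky ∩ Hq) ≤ μ.real (Ky ∩ Ly ∩ Hq) :=
    measureReal_mono (fun ω hω => ⟨⟨hω.1.2, hω.1.1.2⟩, hω.2⟩) (measure_ne_top μ _)
  have h3b : μ.real (Ky ∩ Hy ∩ Lq) ≤ μ.real (Kqᶜ ∩ Lq ∩ Hy) := by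
    refine measureReal_mono (fun ω hω => ⟨⟨?_, hω.2⟩, hω.1.2⟩) (measure_ne_top μ _)
    -- `c ↔ y`, `y` heavy, `q` light ⇒ `c ↮ q`
    intro hkq
    have e := filter_eq_of_openConn A (show ω ∈ (openConn c q : Set (BondConfig (Fin n))) from hkq)
    have e' := filter_eq_of_openConn A (show ω ∈ (openConn c y : Set (BondConfig (Fin n))) from hω.1.1)
    have hq' : (A.filter fun a => ω ∈ openConn q a).card ≤ j := hω.2
    have hy' : j < (A.filter fun a => ω ∈ openConn y a).card := hω.1.2
    rw [← e, e'] at hq'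
    exact absurd hq' (not_le.2 hy')
  -- (4) assemble
  have eA : μ.real (Kqᶜ ∩ Kyᶜ ∩ Lc) = μ.real (Kqᶜ ∩ Lc) - μ.real (Kqᶜ ∩ Ly ∩ Ky) := by
    have := splitK (Kqᶜ ∩ Lc)
    rw [h2] at this
    have e : Kqᶜ ∩ Lc ∩ Kyᶜ = Kqᶜ ∩ Kyᶜ ∩ Lc := by rw [inter_assoc, inter_comm Lc, ← inter_assoc]
    rw [e] at this
    linarith
  have eB : μ.real (Kqᶜ ∩ Kyᶜ ∩ Lq ∩ Ly) = μ.real (Kqᶜ ∩ Lq ∩ Ly) - μ.real (Kqᶜ ∩ Lq ∩ Ly ∩ Ky) := by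
    have := splitK (Kqᶜ ∩ Lq ∩ Ly)
    have e : Kqᶜ ∩ Lq ∩ Ly ∩ Kyᶜ = Kqᶜ ∩ Kyᶜ ∩ Lq ∩ Ly := by
      ext ω; simp only [mem_inter_iff]; tauto
    rw [e] at this
    linarith
  have eC : μ.real (Kqᶜ ∩ Lq) = μ.real (Kqᶜ ∩ Lq ∩ Ly) + μ.real (Kqᶜ ∩ Lq ∩ Hy) := splitL (Kqᶜ ∩ Lq)
  have eD : μ.real (Kqᶜ ∩ Ly ∩ Ky) = μ.real (Kqᶜ ∩ Ly ∩ Ky ∩ Lq) + μ.real (Kqᶜ ∩ Ly ∩ Ky ∩ Hq) := splitLq (Kqᶜ ∩ Ly ∩ Ky)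
  have eE : Kqᶜ ∩ Ly ∩ Ky ∩ Lq = Kqᶜ ∩ Lq ∩ Ly ∩ Ky := by
    ext ω; simp only [mem_inter_iff]; tauto
  rw [eE] at eD
  rw [eA, eB]
  linarith [h1, h3, h3a, h3b, eC, eD, hnn (Kqᶜ ∩ Lq ∩ Ly ∩ Ky)]

/-- `{|π(s₀)| > j}` is of type `(+)` for `(C_S, C_T)` whenever `s₀ ∈ S`. [folklore] -/
theorem heavy_typePlus_of_mem (A : Finset (Fin n)) (S T : Set (Fin n)) {s₀ : Fin n} (hs₀ : s₀ ∈ S) (j : ℕ)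
    ⦃ω ω' : BondConfig (Fin n)⦄
    (hs : (⋃ s ∈ S, openEdgeCluster ω s) ⊆ (⋃ s ∈ S, openEdgeCluster ω' s))
    (ht : (⋃ t ∈ T, openEdgeCluster ω' t) ⊆ (⋃ t ∈ T, openEdgeCluster ω t))
    (h : ω ∈ {ω : BondConfig (Fin n) | j < (A.filter fun a => ω ∈ openConn s₀ a).card}) :
    ω' ∈ {ω : BondConfig (Fin n) | j < (A.filter fun a => ω ∈ openConn s₀ a).card} := by
  simp only [mem_setOf_eq] at h ⊢
  refine lt_of_lt_of_le h (Finset.card_le_card fun a ha => ?_)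
  simp only [Finset.mem_filter] at ha ⊢
  exact ⟨ha.1, TwoSetExchange.typePlus_openConn_of_mem S T hs₀ a hs ht ha.2⟩

/-- `{|π(t₀)| ≤ j}` is of type `(+)` for `(C_S, C_T)` whenever `t₀ ∈ T`. [folklore] -/
theorem light_typePlus_of_mem (A : Finset (Fin n)) (S T : Set (Fin n)) {t₀ : Fin n} (ht₀ : t₀ ∈ T) (j : ℕ)
    ⦃ω ω' : BondConfig (Fin n)⦄
    (hs : (⋃ s ∈ S, openEdgeCluster ω s) ⊆ (⋃ s ∈ S, openEdgeCluster ω' s))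
    (ht : (⋃ t ∈ T, openEdgeCluster ω' t) ⊆ (⋃ t ∈ T, openEdgeCluster ω t))
    (h : ω ∈ {ω : BondConfig (Fin n) | (A.filter fun a => ω ∈ openConn t₀ a).card ≤ j}) :
    ω' ∈ {ω : BondConfig (Fin n) | (A.filter fun a => ω ∈ openConn t₀ a).card ≤ j} := by
  simp only [mem_setOf_eq] at h ⊢
  refine le_trans (Finset.card_le_card fun a ha => ?_) h
  simp only [Finset.mem_filter] at ha ⊢
  refine ⟨ha.1, ?_⟩
  by_contra hω
  exact TwoSetExchange.typePlus_not_openConn_of_mem S T ht₀ a hs ht hω ha.2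

/-- **Positive correlation of two type-`(+)` events given `{q,y} ↮ c`.**
`μ(D ∩ E₁) · μ(D ∩ E₂) ≤ μ(D ∩ (E₁ ∩ E₂)) · μ(D)`, `D = {q↮c} ∩ {y↮c}`.
[cite: VandenbergHaggstromKahn2005, Thm. 2.1 (p. 9) at q = 1 — corollary] -/
theorem posCorr_typePlus_pair (w : Sym2 (Fin n) → unitInterval) (q y c : Fin n) {E₁ E₂ : Set (BondConfig (Fin n))}
    (hE₁ : ∀ ⦃ω ω' : BondConfig (Fin n)⦄,
      (⋃ s ∈ ({q, y} : Set (Fin n)), openEdgeCluster ω s) ⊆ (⋃ s ∈ ({q, y} : Set (Fin n)), openEdgeCluster ω' s) →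
      (⋃ t ∈ ({c} : Set (Fin n)), openEdgeCluster ω' t) ⊆ (⋃ t ∈ ({c} : Set (Fin n)), openEdgeCluster ω t) →
      ω ∈ E₁ → ω' ∈ E₁)
    (hE₂ : ∀ ⦃ω ω' : BondConfig (Fin n)⦄,
      (⋃ s ∈ ({q, y} : Set (Fin n)), openEdgeCluster ω s) ⊆ (⋃ s ∈ ({q, y} : Set (Fin n)), openEdgeCluster ω' s) →
      (⋃ t ∈ ({c} : Set (Fin n)), openEdgeCluster ω' t) ⊆ (⋃ t ∈ ({c} : Set (Fin n)), openEdgeCluster ω t) →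
      ω ∈ E₂ → ω' ∈ E₂) :
    (prodBernoulli w).real ((openConn q c : Set (BondConfig (Fin n)))ᶜ ∩ (openConn y c : Set (BondConfig (Fin n)))ᶜ ∩ E₁) *
        (prodBernoulli w).real ((openConn q c : Set (BondConfig (Fin n)))ᶜ ∩ (openConn y c : Set (BondConfig (Fin n)))ᶜ ∩ E₂) ≤
      (prodBernoulli w).real ((openConn q c : Set (BondConfig (Fin n)))ᶜ ∩ (openConn y c : Set (BondConfig (Fin n)))ᶜ ∩ (E₁ ∩ E₂)) *
        (prodBernoulli w).real ((openConn q c : Set (BondConfig (Fin n)))ᶜ ∩ (openConn y c : Set (BondConfig (Fin n)))ᶜ) := by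
  have key := setTwoClusterExchange w ({q, y} : Set (Fin n)) ({c} : Set (Fin n))
    (A₁ := E₁) (A₂ := E₂) (B₁ := univ) (B₂ := univ) hE₁ hE₂
    (fun _ _ _ _ _ => mem_univ _) (fun _ _ _ _ _ => mem_univ _)
  rw [sep_pair_eq q y c] at key
  simpa only [inter_univ, univ_inter] using key

/-- **Set conditioned exchange for a pair.**  If `S(y) ≤ S(q) ≤ S(c)` and `E` is of type `(+)` for `(C_{{q,y}}, C_{{c}})`, then
`μ(E ∩ R_q ∩ R_y) ≤ μ(E ∩ R_c)`. [this work] -/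
theorem exchange_typePlus_pair (w : Sym2 (Fin n) → unitInterval) (A : Finset (Fin n)) (q y c : Fin n) (j : ℕ)
    {E : Set (BondConfig (Fin n))}
    (hE : ∀ ⦃ω ω' : BondConfig (Fin n)⦄,
      (⋃ s ∈ ({q, y} : Set (Fin n)), openEdgeCluster ω s) ⊆ (⋃ s ∈ ({q, y} : Set (Fin n)), openEdgeCluster ω' s) →
      (⋃ t ∈ ({c} : Set (Fin n)), openEdgeCluster ω' t) ⊆ (⋃ t ∈ ({c} : Set (Fin n)), openEdgeCluster ω t) →
      ω ∈ E → ω' ∈ E)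
    (hqc : (prodBernoulli w).real {ω : BondConfig (Fin n) | (A.filter fun a => ω ∈ openConn q a).card ≤ j} ≤
      (prodBernoulli w).real {ω : BondConfig (Fin n) | (A.filter fun a => ω ∈ openConn c a).card ≤ j})
    (hyq : (prodBernoulli w).real {ω : BondConfig (Fin n) | (A.filter fun a => ω ∈ openConn y a).card ≤ j} ≤
      (prodBernoulli w).real {ω : BondConfig (Fin n) | (A.filter fun a => ω ∈ openConn q a).card ≤ j}) :
    (prodBernoulli w).real (E ∩ {ω : BondConfig (Fin n) | (A.filter fun a => ω ∈ openConn q a).card ≤ j} ∩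
        {ω : BondConfig (Fin n) | (A.filter fun a => ω ∈ openConn y a).card ≤ j}) ≤
      (prodBernoulli w).real (E ∩ {ω : BondConfig (Fin n) | (A.filter fun a => ω ∈ openConn c a).card ≤ j}) := by
  set μ := prodBernoulli w with hμ
  set Kq : Set (BondConfig (Fin n)) := (openConn c q : Set (BondConfig (Fin n))) with hKq
  set Ky : Set (BondConfig (Fin n)) := (openConn c y : Set (BondConfig (Fin n))) with hKy
  set D : Set (BondConfig (Fin n)) := (openConn q c : Set (BondConfig (Fin n)))ᶜ ∩ (openConn y c : Set (BondConfig (Fin n)))ᶜ with hD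
  set Lq : Set (BondConfig (Fin n)) := {ω | (A.filter fun a => ω ∈ openConn q a).card ≤ j} with hLq
  set Ly : Set (BondConfig (Fin n)) := {ω | (A.filter fun a => ω ∈ openConn y a).card ≤ j} with hLy
  set Lc : Set (BondConfig (Fin n)) := {ω | (A.filter fun a => ω ∈ openConn c a).card ≤ j} with hLc
  set Hq : Set (BondConfig (Fin n)) := {ω | j < (A.filter fun a => ω ∈ openConn q a).card} with hHq
  set Hy : Set (BondConfig (Fin n)) := {ω | j < (A.filter fun a => ω ∈ openConn y a).card} with hHy
  have hmeas : ∀ s : Set (BondConfig (Fin n)), MeasurableSet s := fun _ => MeasurableSet.of_discrete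
  have hnn : ∀ s : Set (BondConfig (Fin n)), 0 ≤ μ.real s := fun _ => measureReal_nonneg
  have hDeq : D = Kqᶜ ∩ Kyᶜ := by
    rw [hD, hKq, hKy, KNPreFKG.openConn_symm q c, KNPreFKG.openConn_symm y c]
  -- type (+) events
  have hq2 : q ∈ ({q, y} : Set (Fin n)) := mem_insert q {y}
  have hy2 : y ∈ ({q, y} : Set (Fin n)) := mem_insert_of_mem q (mem_singleton y)
  have hc1 : c ∈ ({c} : Set (Fin n)) := mem_singleton c
  have hG₁ : ∀ ⦃ω ω' : BondConfig (Fin n)⦄,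
      (⋃ s ∈ ({q, y} : Set (Fin n)), openEdgeCluster ω s) ⊆ (⋃ s ∈ ({q, y} : Set (Fin n)), openEdgeCluster ω' s) →
      (⋃ t ∈ ({c} : Set (Fin n)), openEdgeCluster ω' t) ⊆ (⋃ t ∈ ({c} : Set (Fin n)), openEdgeCluster ω t) →
      ω ∈ Hq ∪ Hy → ω' ∈ Hq ∪ Hy := by
    rintro ω ω' hs ht (h | h)
    · exact Or.inl (heavy_typePlus_of_mem A _ _ hq2 j hs ht h)
    · exact Or.inr (heavy_typePlus_of_mem A _ _ hy2 j hs ht h)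
  have p1 := posCorr_typePlus_pair w q y c hE hG₁
  have p2 := posCorr_typePlus_pair w q y c hE (light_typePlus_of_mem A ({q, y} : Set (Fin n)) ({c} : Set (Fin n)) hc1 j)
  rw [← hD] at p1 p2
  -- set championship on `D`
  have hSC : μ.real (D ∩ (Lq ∩ Ly)) ≤ μ.real (D ∩ Lc) := by
    have key := setChampionship_pair w A q y c j hqc hyq
    rw [hDeq]
    have e1 : Kqᶜ ∩ Kyᶜ ∩ (Lq ∩ Ly) = Kqᶜ ∩ Kyᶜ ∩ Lq ∩ Ly := (inter_assoc _ _ _).symm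
    rw [e1]
    exact key
  -- `D = (D ∩ (Hq ∪ Hy)) ⊔ (D ∩ Lq ∩ Ly)`
  have hHL : ∀ F : Set (BondConfig (Fin n)), μ.real F = μ.real (F ∩ (Hq ∪ Hy)) + μ.real (F ∩ (Lq ∩ Ly)) := by
    intro F
    have hc : F ∩ (Lq ∩ Ly) = F \ (Hq ∪ Hy) := by
      ext ω
      simp only [mem_inter_iff, mem_sdiff, mem_union, hLq, hLy, hHq, hHy, mem_setOf_eq, not_or, not_lt]
    rw [hc]
    exact (measureReal_inter_add_sdiff (μ := μ) (s := F) (t := Hq ∪ Hy) (hmeas _)).symm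
  have hD1 := hHL D
  have hDE := hHL (D ∩ E)
  have main : μ.real D * μ.real (D ∩ E ∩ (Lq ∩ Ly)) ≤ μ.real D * μ.real (D ∩ E ∩ Lc) := by
    have e1 : D ∩ (E ∩ (Hq ∪ Hy)) = D ∩ E ∩ (Hq ∪ Hy) := (inter_assoc _ _ _).symm
    have e2 : D ∩ (E ∩ Lc) = D ∩ E ∩ Lc := (inter_assoc _ _ _).symm
    rw [e1] at p1
    rw [e2] at p2
    nlinarith [hnn (D ∩ E), hnn (D ∩ (Hq ∪ Hy)), hnn (D ∩ (Lq ∩ Ly)), hnn (D ∩ Lc), hnn D, hnn (D ∩ E ∩ (Hq ∪ Hy)),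
      hnn (D ∩ E ∩ (Lq ∩ Ly)), hnn (D ∩ E ∩ Lc)]
  have hDc : μ.real (D ∩ E ∩ (Lq ∩ Ly)) ≤ μ.real (D ∩ E ∩ Lc) := by
    by_cases h0 : μ.real D = 0
    · have hz : μ.real (D ∩ E ∩ (Lq ∩ Ly)) = 0 :=
        le_antisymm (le_trans (measureReal_mono (show D ∩ E ∩ (Lq ∩ Ly) ⊆ D from
          fun ω hω => hω.1.1) (measure_ne_top μ _)) h0.le) (hnn _)
      rw [hz]; exact hnn _
    · exact le_of_mul_le_mul_left main (lt_of_le_of_ne (hnn _) (Ne.symm h0))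
  -- off `D`: if `c ↔ q` or `c ↔ y` and both are light then `c` is light
  have hoff : μ.real ((E ∩ Lq ∩ Ly) ∩ Dᶜ) ≤ μ.real ((E ∩ Lc) ∩ Dᶜ) := by
    refine measureReal_mono (fun ω hω => ⟨⟨hω.1.1.1, ?_⟩, hω.2⟩) (measure_ne_top μ _)
    have hnD : ω ∉ D := hω.2
    rw [hDeq] at hnD
    simp only [mem_inter_iff, mem_compl_iff, not_and_or, not_not] at hnD
    rcases hnD with hk | hk
    · show (A.filter fun a => ω ∈ openConn c a).card ≤ j
      rw [filter_eq_of_openConn A hk]; exact hω.1.1.2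
    · show (A.filter fun a => ω ∈ openConn c a).card ≤ j
      rw [filter_eq_of_openConn A hk]; exact hω.1.2
  -- assemble
  have s1 : μ.real (E ∩ Lq ∩ Ly) = μ.real ((E ∩ Lq ∩ Ly) ∩ D) + μ.real ((E ∩ Lq ∩ Ly) ∩ Dᶜ) := by
    rw [← Set.sdiff_eq]
    exact (measureReal_inter_add_sdiff (μ := μ) (s := E ∩ Lq ∩ Ly) (t := D) (hmeas _)).symm
  have s2 : μ.real (E ∩ Lc) = μ.real ((E ∩ Lc) ∩ D) + μ.real ((E ∩ Lc) ∩ Dᶜ) := by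
    rw [← Set.sdiff_eq]
    exact (measureReal_inter_add_sdiff (μ := μ) (s := E ∩ Lc) (t := D) (hmeas _)).symm
  have e3 : (E ∩ Lq ∩ Ly) ∩ D = D ∩ E ∩ (Lq ∩ Ly) := by
    ext ω; simp only [mem_inter_iff]; tauto
  have e4 : (E ∩ Lc) ∩ D = D ∩ E ∩ Lc := by
    ext ω; simp only [mem_inter_iff]; tauto
  rw [s1, s2, e3, e4]
  linarith

end ConditionedChampionExchangeSets

open ConditionedChampionExchangeSets

/-- **Pair-attached exchange.**  If `S(y) ≤ S(q) ≤ S(c)` then for every vertex `o`: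
`μ({o↔q} ∩ {o↔y} ∩ R_q ∩ R_y) ≤ μ({o↔q} ∩ {o↔y} ∩ R_c)` — an observer whose pocket contains the pair `{q, y}` still sees the
champion at least as light as its own pocket. [this work] -/
theorem pairAttachedExchange (w : Sym2 (Fin n) → unitInterval) (A : Finset (Fin n)) (o q y c : Fin n) (j : ℕ)
    (hqc : (prodBernoulli w).real {ω : BondConfig (Fin n) | (A.filter fun a => ω ∈ openConn q a).card ≤ j} ≤
      (prodBernoulli w).real {ω : BondConfig (Fin n) | (A.filter fun a => ω ∈ openConn c a).card ≤ j})
    (hyq : (prodBernoulli w).real {ω : BondConfig (Fin n) | (A.filter fun a => ω ∈ openConn y a).card ≤ j} ≤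
      (prodBernoulli w).real {ω : BondConfig (Fin n) | (A.filter fun a => ω ∈ openConn q a).card ≤ j}) :
    (prodBernoulli w).real ((openConn o q : Set (BondConfig (Fin n))) ∩ (openConn o y : Set (BondConfig (Fin n))) ∩
        {ω | (A.filter fun a => ω ∈ openConn q a).card ≤ j} ∩ {ω | (A.filter fun a => ω ∈ openConn y a).card ≤ j}) ≤
      (prodBernoulli w).real ((openConn o q : Set (BondConfig (Fin n))) ∩ (openConn o y : Set (BondConfig (Fin n))) ∩
        {ω | (A.filter fun a => ω ∈ openConn c a).card ≤ j}) := by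
  have hq2 : q ∈ ({q, y} : Set (Fin n)) := mem_insert q {y}
  have hy2 : y ∈ ({q, y} : Set (Fin n)) := mem_insert_of_mem q (mem_singleton y)
  have hE : ∀ ⦃ω ω' : BondConfig (Fin n)⦄,
      (⋃ s ∈ ({q, y} : Set (Fin n)), openEdgeCluster ω s) ⊆ (⋃ s ∈ ({q, y} : Set (Fin n)), openEdgeCluster ω' s) →
      (⋃ t ∈ ({c} : Set (Fin n)), openEdgeCluster ω' t) ⊆ (⋃ t ∈ ({c} : Set (Fin n)), openEdgeCluster ω t) →
      ω ∈ (openConn o q : Set (BondConfig (Fin n))) ∩ (openConn o y : Set (BondConfig (Fin n))) →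
      ω' ∈ (openConn o q : Set (BondConfig (Fin n))) ∩ (openConn o y : Set (BondConfig (Fin n))) := by
    intro ω ω' hs ht h
    rw [KNPreFKG.openConn_symm o q, KNPreFKG.openConn_symm o y] at h ⊢
    exact ⟨TwoSetExchange.typePlus_openConn_of_mem _ _ hq2 o hs ht h.1,
      TwoSetExchange.typePlus_openConn_of_mem _ _ hy2 o hs ht h.2⟩
  exact exchange_typePlus_pair w A q y c j hE hqc hyq

/-- **Pair-attached exchange, swap form.**  If `S(y) ≤ S(q) ≤ S(c)` then
`μ({o↔q} ∩ {o↔y} ∩ R_q ∩ {|π(c)| > j}) ≤ μ({o↔q} ∩ {o↔y} ∩ {|π(q)| > j} ∩ R_c)`: the heavy block moves from the champion to the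
observer's two-relay pocket. [this work] -/
theorem pairAttachedExchange_swap (w : Sym2 (Fin n) → unitInterval) (A : Finset (Fin n)) (o q y c : Fin n) (j : ℕ)
    (hqc : (prodBernoulli w).real {ω : BondConfig (Fin n) | (A.filter fun a => ω ∈ openConn q a).card ≤ j} ≤
      (prodBernoulli w).real {ω : BondConfig (Fin n) | (A.filter fun a => ω ∈ openConn c a).card ≤ j})
    (hyq : (prodBernoulli w).real {ω : BondConfig (Fin n) | (A.filter fun a => ω ∈ openConn y a).card ≤ j} ≤
      (prodBernoulli w).real {ω : BondConfig (Fin n) | (A.filter fun a => ω ∈ openConn q a).card ≤ j}) :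
    (prodBernoulli w).real ((openConn o q : Set (BondConfig (Fin n))) ∩ (openConn o y : Set (BondConfig (Fin n))) ∩
        {ω | (A.filter fun a => ω ∈ openConn q a).card ≤ j} ∩ {ω | j < (A.filter fun a => ω ∈ openConn c a).card}) ≤
      (prodBernoulli w).real ((openConn o q : Set (BondConfig (Fin n))) ∩ (openConn o y : Set (BondConfig (Fin n))) ∩
        {ω | j < (A.filter fun a => ω ∈ openConn q a).card} ∩ {ω | (A.filter fun a => ω ∈ openConn c a).card ≤ j}) := by
  set μ := prodBernoulli w with hμ
  set E : Set (BondConfig (Fin n)) := (openConn o q : Set (BondConfig (Fin n))) ∩ (openConn o y : Set (BondConfig (Fin n)))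
    with hEdef
  set Lq : Set (BondConfig (Fin n)) := {ω | (A.filter fun a => ω ∈ openConn q a).card ≤ j} with hLq
  set Ly : Set (BondConfig (Fin n)) := {ω | (A.filter fun a => ω ∈ openConn y a).card ≤ j} with hLy
  set Lc : Set (BondConfig (Fin n)) := {ω | (A.filter fun a => ω ∈ openConn c a).card ≤ j} with hLc
  set Hq : Set (BondConfig (Fin n)) := {ω | j < (A.filter fun a => ω ∈ openConn q a).card} with hHq
  set Hc : Set (BondConfig (Fin n)) := {ω | j < (A.filter fun a => ω ∈ openConn c a).card} with hHc
  have hmeas : ∀ s : Set (BondConfig (Fin n)), MeasurableSet s := fun _ => MeasurableSet.of_discrete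
  have key := pairAttachedExchange w A o q y c j hqc hyq
  -- on `E` the blocks of `q` and `y` coincide, so `R_q ∩ R_y = R_q` there
  have hEq : E ∩ Lq ∩ Ly = E ∩ Lq := by
    ext ω
    constructor
    · rintro ⟨⟨hE, hq⟩, -⟩; exact ⟨hE, hq⟩
    · rintro ⟨hE, hq⟩
      refine ⟨⟨hE, hq⟩, ?_⟩
      have hE' : ω ∈ (openConn o q : Set (BondConfig (Fin n))) ∩ (openConn o y : Set (BondConfig (Fin n))) := by
        rw [hEdef] at hE; exact hE
      have e1 := ConditionedChampionExchange.filter_eq_of_openConn A hE'.1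
      have e2 := ConditionedChampionExchange.filter_eq_of_openConn A hE'.2
      have hq' : (A.filter fun a => ω ∈ openConn q a).card ≤ j := hq
      show (A.filter fun a => ω ∈ openConn y a).card ≤ j
      rw [← e2, e1]; exact hq'
  change μ.real (E ∩ Lq ∩ Ly) ≤ μ.real (E ∩ Lc) at key
  rw [hEq] at key
  have h1 : μ.real (E ∩ Lq) = μ.real (E ∩ Lq ∩ Lc) + μ.real (E ∩ Lq ∩ Hc) := by
    have hc : E ∩ Lq ∩ Hc = (E ∩ Lq) \ Lc := by
      ext ω; simp only [mem_inter_iff, mem_sdiff, hLc, hHc, mem_setOf_eq, not_le]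
    rw [hc]
    exact (measureReal_inter_add_sdiff (μ := μ) (s := E ∩ Lq) (t := Lc) (hmeas _)).symm
  have h2 : μ.real (E ∩ Lc) = μ.real (E ∩ Lq ∩ Lc) + μ.real (E ∩ Hq ∩ Lc) := by
    have hc : E ∩ Hq ∩ Lc = (E ∩ Lc) \ Lq := by
      ext ω; simp only [mem_inter_iff, mem_sdiff, hLq, hHq, mem_setOf_eq, not_le]; tauto
    have hd : E ∩ Lq ∩ Lc = (E ∩ Lc) ∩ Lq := by
      ext ω; simp only [mem_inter_iff]; tauto
    rw [hc, hd]
    exact (measureReal_inter_add_sdiff (μ := μ) (s := E ∩ Lc) (t := Lq) (hmeas _)).symm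
  linarith

end Summit.CriticalPhenomena.PercolationContinuityZ3.Theorems

end
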